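import Literature.RingTheory.RegularLocalRing.PowerSeriesQuotientTower
import Literature.AlgebraicGeometry.Motives.AbelianVarietyTorsionStalkTower
import Literature.AlgebraicGeometry.AbelianSchemes.DualPairHatRelDimTransport
import Literature.AlgebraicGeometry.AbelianSchemes.AbelianLiftObstructionClass
import HarnessLib

/-!
# The special-fibre `ψ`-datum of Tate's algebraization argument: `𝒪_{A,e} ⧸ [pⁿ]^♯𝔪_e` as a
# compatible tower of quotients of `K⟦X₁, …, X_g⟧`

Topic `Literature/AlgebraicGeometry/AbelianSchemes`, namespace `Literature.AlgebraicGeometry.AbelianSchemes`.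
THEOREMS ONLY (no definition, no named fact, no instance); glue of two tree results:

* ★ `Literature.RingTheory.RegularLocalRing.exists_ringHom_mvPowerSeries_quotient_tower` — a regular local ring
  `R` of dimension `g` with a coefficient map `ι : K → R` onto the residue field, read through an antitone, `𝔪`-primary,
  cofinal tower of ideals `I n`, carries compatible SURJECTIONS `ψ n : K⟦X₁, …, X_g⟧ → R ⧸ I n`, `ι` on constants,
  nilpotent on the variables, with `⋂ₙ ker ψ n = 0` (Cohen's structure theorem for `R̂`);
* ★ `Literature.AlgebraicGeometry.Motives.AbelianVariety.exists_stalkOrigin_torsionTower_package` — for an abelian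
  variety `A` over a field `K` with `(p : K) = 0`, `p ≠ 0`, the local ring `R := 𝒪_{A,e}` at the origin with the
  ideals `I n := [pⁿ]^♯ 𝔪_e · 𝒪_{A,e}` is such a datum, of dimension `dim A` (`[p]^♯𝔪_e ⊆ 𝔪_e²` because the cotangent
  map of `[p]` is `p = 0`; `𝔪`-primary because `[pⁿ]` is an isogeny).

Hence (§1) the tower `n ↦ 𝒪_{A,e} ⧸ [pⁿ]^♯𝔪_e` — the local rings at the origin of the torsion subgroup schemes
`A[pⁿ]` — is presented by compatible surjections from `K⟦X₁, …, X_{dim A}⟧` with zero joint kernel: the `k`-step of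
[Tate1967] §2.2 (proof of Prop. 1), by algebraization instead of Frobenius∕Verschiebung. §2 reads it for an abelian
scheme `X → Spec K` of relative dimension `g` (`dim = g`, ★ `dim_toAffine_toAbelianVariety_of_isOfRelDim`), §3 for the
canonical closed fibre `X₀ ×_{A⧸J} κ(A)` of an abelian scheme over an Artinian local quotient `A ⧸ J` with `p`
nilpotent in `A` (★ `closedFibre`) — the shape consumed by the Serre–Tate unit-component tower.

The five conclusion conjuncts are, in order, the hypotheses `hψπ ∕ hψC ∕ hψ_surj ∕ hψX ∕ hψ_ker` of the power-series
presentation of a surjective tower of finite free algebras from its special fibre (tree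
`RingTheory/AdicTopology/PowerSeriesTowerPresentation`), at the carriers `F n := 𝒪_{A,e} ⧸ I n` with transition maps
`Ideal.Quotient.factor`; the constants conjunct is stated through `stalkOriginAlgebraMap`.

## References
* [Tate1967] J. Tate, *p-divisible groups*, Proc. Conf. Local Fields (Driebergen 1966), Springer 1967, §2.2 (proof of
  Prop. 1).
* [GortzWedhorn2023] U. Görtz, T. Wedhorn, *Algebraic Geometry II*, Remark 27.18 (3), Prop. 27.186.
* [Matsumura1987] H. Matsumura, *Commutative Ring Theory*, Thm. 29.7.
-/

noncomputable section

universe u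

open CategoryTheory AlgebraicGeometry IsLocalRing
open Literature.AlgebraicGeometry.Motives Literature.AlgebraicGeometry.Motives.AbelianVariety

namespace Literature.AlgebraicGeometry.AbelianSchemes

/-! ## §1 Abelian varieties over a field of characteristic `p` -/

/-- **The special-fibre `ψ`-datum of an abelian variety.** Let `A` be an abelian variety over a field `K` with
`(p : K) = 0`, `p ≠ 0`, and `dim A = g`; put `R := 𝒪_{A,e}` and `I n := [pⁿ]^♯ 𝔪_e · R`. Then there are ring maps
`ψ n : K⟦X₁, …, X_g⟧ → R ⧸ I n` compatible with the transition maps `R ⧸ I m → R ⧸ I n` (`n ≤ m`), equal to the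
structure map `K → 𝒪_{A,e}` on constants, surjective, nilpotent on the variables, and with `⋂ₙ ker ψ n = 0`
(★ `exists_stalkOrigin_torsionTower_package` fed into ★ `exists_ringHom_mvPowerSeries_quotient_tower`).
[cite: Tate1967, §2.2 (proof of Prop. 1)] [cite: GortzWedhorn2023, Remark 27.18 (3) and Prop. 27.186] -/
theorem exists_ringHom_mvPowerSeries_torsionStalkTower {K : Type u} [Field K] (A : AbelianVariety K) {p : ℕ}
    (hp : p ≠ 0) (hpk : (p : K) = 0) {g : ℕ} (hg : A.dim = g) :
    ∃ ψ : ∀ n : ℕ, MvPowerSeries (Fin g) K →+*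
        ↥(stalkOrigin A) ⧸ (maximalIdeal (stalkOrigin A)).map (stalkMapEnd A (((p ^ n : ℕ) : ℤ) • 𝟙 A)).hom,
      (∀ ⦃n m : ℕ⦄ (h : n ≤ m) (G : MvPowerSeries (Fin g) K),
          Ideal.Quotient.factor (A.antitone_torsionStalkIdeal hpk h) (ψ m G) = ψ n G) ∧
      (∀ n (c : K), ψ n (MvPowerSeries.C c) = Ideal.Quotient.mk
          ((maximalIdeal (stalkOrigin A)).map (stalkMapEnd A (((p ^ n : ℕ) : ℤ) • 𝟙 A)).hom)
          (stalkOriginAlgebraMap A c)) ∧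
      (∀ n, Function.Surjective (ψ n)) ∧
      (∀ n (s : Fin g), IsNilpotent (ψ n (MvPowerSeries.X s))) ∧
      ⨅ n, RingHom.ker (ψ n) = ⊥ := by
  obtain ⟨h1, h2, h3, h4, h5, -, h7⟩ := exists_stalkOrigin_torsionTower_package A hp hpk
  haveI := h1
  have hdim : ringKrullDim (stalkOrigin A) = g := by rw [h2, hg]
  exact Literature.RingTheory.RegularLocalRing.exists_ringHom_mvPowerSeries_quotient_tower
    (stalkOriginAlgebraMap A) h3 hdim _ h4 h5 h7

/-! ## §2 Abelian schemes over `Spec K` of relative dimension `g` -/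

namespace AbelianSchemeOver

/-- **The special-fibre `ψ`-datum of an abelian scheme `X → Spec K` of relative dimension `g`** (`(p : K) = 0`,
`p ≠ 0`), for the abelian variety `X.toAffine.toAbelianVariety` (same `K`-group scheme) whose `dim` is `g`
(★ `dim_toAffine_toAbelianVariety_of_isOfRelDim`): compatible surjections
`K⟦X₁, …, X_g⟧ → 𝒪_{X,e} ⧸ [pⁿ]^♯ 𝔪_e` as in §1. [cite: Tate1967, §2.2 (proof of Prop. 1)]
[cite: GortzWedhorn2020, Remark 16.54 (p. 539)] -/
theorem exists_ringHom_mvPowerSeries_torsionStalkTower_of_isOfRelDim {K : Type u} [Field K]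
    (X : AbelianSchemeOver (Spec (.of K))) {g : ℕ} (hX : X.IsOfRelDim g) {p : ℕ} (hp : p ≠ 0)
    (hpk : (p : K) = 0) :
    ∃ ψ : ∀ n : ℕ, MvPowerSeries (Fin g) K →+*
        ↥(stalkOrigin X.toAffine.toAbelianVariety) ⧸
          (maximalIdeal (stalkOrigin X.toAffine.toAbelianVariety)).map (stalkMapEnd X.toAffine.toAbelianVariety
            (((p ^ n : ℕ) : ℤ) • 𝟙 X.toAffine.toAbelianVariety)).hom,
      (∀ ⦃n m : ℕ⦄ (h : n ≤ m) (G : MvPowerSeries (Fin g) K),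
          Ideal.Quotient.factor (X.toAffine.toAbelianVariety.antitone_torsionStalkIdeal hpk h) (ψ m G) = ψ n G) ∧
      (∀ n (c : K), ψ n (MvPowerSeries.C c) = Ideal.Quotient.mk
          ((maximalIdeal (stalkOrigin X.toAffine.toAbelianVariety)).map (stalkMapEnd X.toAffine.toAbelianVariety
            (((p ^ n : ℕ) : ℤ) • 𝟙 X.toAffine.toAbelianVariety)).hom)
          (stalkOriginAlgebraMap X.toAffine.toAbelianVariety c)) ∧
      (∀ n, Function.Surjective (ψ n)) ∧
      (∀ n (s : Fin g), IsNilpotent (ψ n (MvPowerSeries.X s))) ∧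
      ⨅ n, RingHom.ker (ψ n) = ⊥ :=
  exists_ringHom_mvPowerSeries_torsionStalkTower X.toAffine.toAbelianVariety hp hpk
    (dim_toAffine_toAbelianVariety_of_isOfRelDim hX)

/-! ## §3 The canonical closed fibre of an abelian scheme over `A ⧸ J`, `p` nilpotent in `A` -/

/-- `p` nilpotent in a local ring `A` vanishes in the residue field `κ(A)` (private plumbing; any proof of
`(p : κ(A)) = 0` may be supplied in its place by proof irrelevance). [folklore] -/
private theorem natCast_residueField_eq_zero_of_isNilpotent {A : Type*} [CommRing A] [IsLocalRing A] {p : ℕ}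
    (hpA : IsNilpotent (p : A)) : (p : ResidueField A) = 0 := by
  have h : IsNilpotent (IsLocalRing.residue A (p : A)) := hpA.map (IsLocalRing.residue A)
  rw [map_natCast] at h
  exact h.eq_zero

/-- **The special-fibre `ψ`-datum of the canonical closed fibre.** Let `p` be a prime, `A` an Artinian local ring with
`p` nilpotent in `A`, `J ≠ ⊤` an ideal, and `X₀ → Spec (A ⧸ J)` an abelian scheme of relative dimension `g`; let
`X_κ := X₀ ×_{A⧸J} κ(A)` be its canonical closed fibre (★ `closedFibre`), an abelian variety over `κ(A)` of dimension
`g`. Then the local rings at the origin of its `pⁿ`-torsion, `𝒪_{X_κ,e} ⧸ [pⁿ]^♯ 𝔪_e`, form a tower presented by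
compatible surjections from `κ(A)⟦X₁, …, X_g⟧`, the structure map on constants, nilpotent on the variables, with zero
joint kernel. [cite: Tate1967, §2.2 (proof of Prop. 1)] [cite: Oort1971, §2.2 (pp. 277–280)] -/
theorem exists_ringHom_mvPowerSeries_torsionStalkTower_closedFibre (p : ℕ) (hp : p.Prime) {A : Type}
    [CommRing A] [IsArtinianRing A] [IsLocalRing A] (hpA : IsNilpotent (p : A)) {J : Ideal A} (hJ : J ≠ ⊤)
    {g : ℕ} (X₀ : AbelianSchemeOver (Spec (.of (A ⧸ J)))) (hX₀ : X₀.IsOfRelDim g) :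
    ∃ ψ : ∀ n : ℕ, MvPowerSeries (Fin g) (ResidueField A) →+*
        ↥(stalkOrigin (closedFibre hJ X₀).toAffine.toAbelianVariety) ⧸
          (maximalIdeal (stalkOrigin (closedFibre hJ X₀).toAffine.toAbelianVariety)).map
            (stalkMapEnd (closedFibre hJ X₀).toAffine.toAbelianVariety
              (((p ^ n : ℕ) : ℤ) • 𝟙 (closedFibre hJ X₀).toAffine.toAbelianVariety)).hom,
      (∀ ⦃n m : ℕ⦄ (h : n ≤ m) (G : MvPowerSeries (Fin g) (ResidueField A)),
          Ideal.Quotient.factor ((closedFibre hJ X₀).toAffine.toAbelianVariety.antitone_torsionStalkIdeal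
            (natCast_residueField_eq_zero_of_isNilpotent hpA) h) (ψ m G) = ψ n G) ∧
      (∀ n (c : ResidueField A), ψ n (MvPowerSeries.C c) = Ideal.Quotient.mk
          ((maximalIdeal (stalkOrigin (closedFibre hJ X₀).toAffine.toAbelianVariety)).map
            (stalkMapEnd (closedFibre hJ X₀).toAffine.toAbelianVariety
              (((p ^ n : ℕ) : ℤ) • 𝟙 (closedFibre hJ X₀).toAffine.toAbelianVariety)).hom)
          (stalkOriginAlgebraMap (closedFibre hJ X₀).toAffine.toAbelianVariety c)) ∧
      (∀ n, Function.Surjective (ψ n)) ∧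
      (∀ n (s : Fin g), IsNilpotent (ψ n (MvPowerSeries.X s))) ∧
      ⨅ n, RingHom.ker (ψ n) = ⊥ :=
  exists_ringHom_mvPowerSeries_torsionStalkTower_of_isOfRelDim (closedFibre hJ X₀)
    (hX₀.baseChange (residueBaseMap hJ)) hp.ne_zero (natCast_residueField_eq_zero_of_isNilpotent hpA)

end AbelianSchemeOver

end Literature.AlgebraicGeometry.AbelianSchemes

end
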